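import Mathlib
import HarnessLib

/-!
# QUANT lane R8, T-DEC, leg (III), blob case — `LawDec.GatedSliceMixLaw'`, Q-alone side: the GENERAL offer-from-surplus lemma of piece 3 and the
# LIGHT-TOP scalar lemmas (twin closed): `S·γ ≤ (1−z)λt` and `k₁A ≤ C(t/γ − K)`

builds on p205010 (kernel theorem, internal audit signed; external expert review pending)

Support file (`--supports stmt-CriticalPhenomena-4575`), QUANT lane seat prim-quant-arm-1 (gen 41), rung R8 of
`run/shared/lean/prim/quant/LADDER.md`.  Pure real-arithmetic lemmas (theorems only, standard axioms, no sorries), consumed by `…QuantGatedSliceMixLawQLightTop`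
(light-top cells of classes `mm`/`mM`).  Notation as in `…QTwinOpenIneq`: `W = t − 2k₁`; `A, B, C, D` the masses of `Q` at `k₁, P = k₁+a, K = k₂, G = K+a`;
light top: `ρ_K = W/(K−k₁) < y`, gate `γ = y² + (1−y)ρ_K`, `usage = γ/(1−γ)`, `capK = C(1−γ)/γ`, surplus `t·capK − (K−t)C = C(t/γ − K)`.
EXACT CENSUS (memo §4b, `work/explore/qlight.py`): with the twin closed the light-top inequality `S·γ ≤ (1−z)λt` holds in every instance
(mm 20 241, mM 32 909 / 0).  RATE class log\* / honest sentence unchanged.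

[this work].  Nothing here is cited as a published result.  The gluing rows served [cite: KozmaNitzan2024, Conjecture 3 (p. 15)].
-/

namespace Summit.CriticalPhenomena.PercolationContinuityZ3.Theorems

namespace Quant

namespace LawDec


/-- **THE OFFER INEQUALITY FROM SURPLUSES (general; any rates).**  With the mean identity `t·z = −(t−k₁)A − (t−P)B − (t−K)C + (G−t)D`,
`y·G ≤ t`, and the surpluses `S_P = t·capP + (t−P)B`, `S_K = t·capK + (t−K)C` of the saturated twin / top: `k₁·A ≤ S_P + S_K ⟹
y(z + A − capP − capK) ≤ (1−y)D` (`= u(z + x_G) ≤ D`, the zero's offer inequality of piece 3). [this work] -/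
theorem mixLawQ_offer_of_surplus (t y k₁ K a A B C D z capP capK SP SK : ℝ) (hy0 : 0 < y) (ht0 : 0 < t)
    (htz : t * z = -((t - k₁) * A) - (t - (k₁ + a)) * B - (t - K) * C + (K + a - t) * D)
    (hyG : y * (K + a) ≤ t) (hD0 : 0 ≤ D)
    (hSP : SP = t * capP + (t - (k₁ + a)) * B) (hSK : SK = t * capK + (t - K) * C)
    (h : k₁ * A ≤ SP + SK) :
    y * (z + (A - capP - capK)) ≤ (1 - y) * D := by
  have e : t * (z + (A - capP - capK)) = k₁ * A - SP - SK + (K + a - t) * D := by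
    rw [hSP, hSK]; linear_combination htz
  have hGD : (K + a - t) * D * y ≤ (t - t * y) * D := by nlinarith [mul_le_mul_of_nonneg_right hyG hD0]
  have h2 : y * (t * (z + (A - capP - capK))) ≤ (t - t * y) * D := by
    rw [e]; nlinarith
  have h3 : t * (y * (z + (A - capP - capK))) ≤ t * ((1 - y) * D) := by
    have e2 : t * (y * (z + (A - capP - capK))) = y * (t * (z + (A - capP - capK))) := by ring
    have e3 : t * ((1 - y) * D) = (t - t * y) * D := by ring
    rw [e2, e3]; exact h2
  exact le_of_mul_le_mul_left h3 ht0

/-- **light top, twin closed: `S·γ ≤ (1−z)λt`**, `γ = y² + (1−y)W/(K−k₁)` (from TA `yK ≤ S`, light `W < y(K−k₁)`, `2k₁ + a ≤ t`; memo §4b). [this work] -/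
theorem mixLawQ_light_closed_gate (z S t lam k₁ K a y g : ℝ) (hz0 : 0 ≤ z) (hz1 : z < 1) (hy0 : 0 < y) (hy1 : y < 1) (hg0 : 0 ≤ g) (hg1 : g ≤ 1)
    (hk₁0 : 0 ≤ k₁) (hkK : k₁ < K) (ha0 : 0 ≤ a) (hmean : (1 - z) * (k₁ + (K - k₁) * lam) = S) (ht : t = S + a * g * (1 - z))
    (hTA : y * K ≤ S) (hlight : t - 2 * k₁ < y * (K - k₁)) (hP : 2 * k₁ + a ≤ t) :
    S * (y ^ 2 + (1 - y) * ((t - 2 * k₁) / (K - k₁))) ≤ (1 - z) * lam * t := by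
  have hd : 0 < K - k₁ := by linarith
  have h1z : 0 < 1 - z := by linarith
  set d := a * g * (1 - z) with hd_def
  have hd0 : 0 ≤ d := mul_nonneg (mul_nonneg ha0 hg0) h1z.le
  have hda : d ≤ a := by
    have : g * (1 - z) ≤ 1 := by nlinarith
    nlinarith
  have hS0 : 0 ≤ S := by rw [← hmean]; exact mul_nonneg h1z.le (by nlinarith)
  -- multiply by (K − k₁)
  have key : S * (y ^ 2 * (K - k₁) + (1 - y) * (t - 2 * k₁)) ≤ (1 - z) * lam * t * (K - k₁) := by
    have e1 : (1 - z) * lam * t * (K - k₁) = t * (S - (1 - z) * k₁) := by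
      have : (1 - z) * ((K - k₁) * lam) = S - (1 - z) * k₁ := by linarith [hmean]
      linear_combination t * this
    rw [e1]
    -- TA: S y²(K−k₁) ≤ S y (S − y k₁)
    have hta2 : y ^ 2 * (K - k₁) ≤ y * (S - y * k₁) := by nlinarith
    have h2 : S * (y ^ 2 * (K - k₁) + (1 - y) * (t - 2 * k₁)) ≤ S * (y * (S - y * k₁) + (1 - y) * (t - 2 * k₁)) := by
      apply mul_le_mul_of_nonneg_left _ hS0; linarith
    refine h2.trans ?_
    -- goal: S (y(S − yk₁) + (1−y)(t−2k₁)) ≤ t (S − (1−z)k₁)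
    --  ⟺ k₁ d (1−z) ≤ S y d + k₁ S z + k₁ S (1−y)²   with t = S + d
    rw [ht]
    by_cases hk : k₁ * (1 - z) ≤ S * y
    · nlinarith [mul_le_mul_of_nonneg_right hk hd0, mul_nonneg hk₁0 hS0, mul_nonneg (mul_nonneg hk₁0 hS0) hz0,
        mul_nonneg (mul_nonneg hk₁0 hS0) (sq_nonneg (1 - y))]
    · have hk' : S * y < k₁ * (1 - z) := not_le.1 hk
      -- light: d < (2 − y) k₁ ; twin closed: 2k₁ ≤ S
      have hl : d < (2 - y) * k₁ := by
        have : y * (K - k₁) ≤ S - y * k₁ := by linarith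
        rw [ht] at hlight; linarith
      have hk2 : 2 * k₁ ≤ S := by rw [ht] at hP; linarith
      have hX : 0 ≤ k₁ * (1 - z) - S * y := by linarith
      have h3 := mul_le_mul_of_nonneg_right hl.le hX
      have h4 : 0 ≤ k₁ * (S - 2 * k₁) := mul_nonneg hk₁0 (by linarith)
      have e3 : (S + d) * (S - (1 - z) * k₁) - S * (y * (S - y * k₁) + (1 - y) * (S + d - 2 * k₁))
          = S * k₁ * (z + (1 - y) ^ 2) - d * (k₁ * (1 - z) - S * y) := by ring
      have h5 : 0 ≤ S * k₁ * (z + (1 - y) ^ 2) := mul_nonneg (mul_nonneg hS0 hk₁0) (by nlinarith [sq_nonneg (1 - y)])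
      have h6 : (2 - y) * k₁ * (k₁ * (1 - z) - S * y) ≤ S * k₁ * (z + (1 - y) ^ 2) := by
        -- = k₁[(S − 2k₁) + S z + k₁(2z + y(1−z))] ≥ 0 after rearrangement
        have e4 : S * k₁ * (z + (1 - y) ^ 2) - (2 - y) * k₁ * (k₁ * (1 - z) - S * y)
            = k₁ * (S - 2 * k₁) + k₁ * S * z + k₁ * k₁ * (2 * z + y * (1 - z)) := by ring
        nlinarith [e4, h4, mul_nonneg (mul_nonneg hk₁0 hS0) hz0, mul_nonneg (mul_nonneg hk₁0 hk₁0) (by nlinarith : (0:ℝ) ≤ 2 * z + y * (1 - z))]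
      linarith [e3, h3, h5, h6]
  have e2 : S * (y ^ 2 + (1 - y) * ((t - 2 * k₁) / (K - k₁))) * (K - k₁) = S * (y ^ 2 * (K - k₁) + (1 - y) * (t - 2 * k₁)) := by
    field_simp
  refine le_of_mul_le_mul_right ?_ hd
  rw [e2]; exact key

/-- **from `S·γ ≤ (1−z)λt` the light top's surplus pays the whole deficit of `k₁`: `k₁·A ≤ C·(t/γ − K)`.** [this work] -/
theorem mixLawQ_surplus_light_ge (z S t lam k₁ K g γ : ℝ) (hg1 : g ≤ 1) (hγ0 : 0 < γ)
    (hL : S * γ ≤ (1 - z) * lam * t) (hmeanK : (1 - z) * lam * K = S - (1 - z) * k₁ + (1 - z) * lam * k₁) :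
    k₁ * ((1 - z) * (1 - lam) * (1 - g)) ≤ ((1 - z) * lam * (1 - g)) * (t / γ - K) := by
  have h1 : S ≤ (1 - z) * lam * (t / γ) := by
    rw [mul_div_assoc']
    rw [le_div_iff₀ hγ0]; linarith
  have h2 : (1 - z) * k₁ * (1 - lam) ≤ (1 - z) * lam * (t / γ - K) := by nlinarith
  have h1g : 0 ≤ 1 - g := by linarith
  nlinarith [mul_le_mul_of_nonneg_right h2 h1g]

end LawDec

end Quant

end Summit.CriticalPhenomena.PercolationContinuityZ3.Theorems
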